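import Literature.AlgebraicGeometry.Motives.HodgeLieWeightOnePlusLineSimple
import Literature.AlgebraicGeometry.Motives.HodgeThetaSubalgebraSymplecticRankFour
import Literature.AlgebraicGeometry.Motives.HodgeLieDerivedSemisimple
import Literature.AlgebraicGeometry.Motives.HodgeLieIsomorphismInvariance
import Literature.AlgebraicGeometry.Motives.SpanCLieEquivBaseChange
import Literature.Algebra.Lie.SimpleIdealsOfComplexification
import Literature.Algebra.Lie.KillingBaseChange
import HarnessLib

/-!
# Weight one, plus pair: the ideal `𝔰 = ⟨B₀, C₀, Θ⟩ ≅ 𝔰𝔩₂` of `Lie Hg ⊗ ℂ` is everything or has a three-dimensional twin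
# (Jacobson X §1 applied to the `ℚ`-simple `Lie Hg`; Moonen–Zarhin (2.3), Mumford's type-III position)

Topic `Literature/AlgebraicGeometry/Motives` (namespace `Literature.AlgebraicGeometry.Motives.HodgeStructure`).  Theorems only
(no definition, no named fact; D-0026).  Sequel of `HodgeLieWeightOnePlusLineSimple` (`Lie Hg` is `ℚ`-simple in the plus-line
position), `SpanCLieEquivBaseChange` (`ℂ ⊗_ℚ 𝔏 ≃ 𝔏'`) and `Literature.Algebra.Lie.SimpleIdealsOfComplexification` (simple ideals
of `ℂ ⊗_ℚ 𝔏` come in equal dimensions), written for the cell `pub-hodge-ring2` (literature lane gen 67, programme R44 step F3h;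
honest framing of that cell: research route conditional on HC_CM; not a corollary; Q11.4-sentence-2 already refuted in dim ≥ 3 —
this file is unconditional Hodge–Lie theory).

SETTING.  `H` polarized effective of weight `1`, `Θ` the Deligne grading (`+1` on `P = V^{1,0}`, `−1` on `Q = V^{0,1}`), and the
PLUS-PAIR data of `HodgeThetaSubalgebraSymplecticRankTen.SymplecticThetaTen.dichotomy`: `B₀ ∈ 𝔥_ℂ` raising (`B₀ P = 0`,
`B₀ V ⊆ P`), `C₀ = B̄₀`, `B₀ C₀ = μ₀` on `P`, `C₀ B₀ = μ₀` on `Q`, and the raising (resp. lowering) operators of `𝔥_ℂ` form the LINE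
`ℂ B₀` (resp. `ℂ C₀`); `𝔷(𝔥) = 0`.

* §1 `PlusPairTwin.facts` — `[B₀, C₀] = μ₀ Θ`, `[Θ, B₀] = 2 B₀`, `[Θ, C₀] = −2 C₀`; `PlusPairTwin.lie_mem_span` — `𝔰 := ⟨B₀, C₀, Θ⟩_ℂ`
  is an IDEAL of `𝔥_ℂ`; `PlusPairTwin.span_le_of_ideal` — every non-zero `ad 𝔥_ℂ`-stable subspace of `𝔰` is `𝔰` (so `𝔰 ≅ 𝔰𝔩₂` is a
  minimal ideal); `PlusPairTwin.finrank_span` — `dim 𝔰 = 3`.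
* §2 **`exists_twin_ideal_of_plusPair`** — EITHER `𝔥_ℂ = 𝔰`, OR `𝔥_ℂ = W ⊕ C` with ideals `W`, `C`, `[W, C] = 0`, `dim W = 3` and
  `[W, 𝔰] = 0`.  PROOF: `𝔥` is `ℚ`-simple (`isSimple_hodgeLie_of_plusLine`), so `A = ℂ ⊗_ℚ 𝔥 ≃ 𝔥_ℂ`
  (`exists_lieEquiv_baseChange_spanC`) is semisimple (`KillingBaseChange.isSemisimple_baseChange`); the pull-back `S` of `𝔰` is a
  minimal ideal, hence simple (`LieAlgebra.IsSemisimple.isSimple_of_isAtom`), with complement `Sᶜ`; by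
  `exists_ideal_finrank_eq_of_isSimple_ideal` either `Sᶜ = 0` or `Sᶜ` contains an ideal `W` with `dim W = dim S = 3`, and
  `[W, S] ⊆ W ∩ S = 0`.

## References

* [Jacobson1962LieAlgebras] N. Jacobson, *Lie Algebras* (1962), Ch. X §1, Theorems 1–3 (pp. 290–293).
* [Deligne1982HodgeCycles] P. Deligne, *Hodge cycles on abelian varieties*, LNM 900 (1982), I §3, Prop. 3.4, 3.6, Example 3.7.
* [MoonenZarhin1999LowDim] B. Moonen, Yu. Zarhin, *Hodge classes on abelian varieties of low dimension*, Math. Ann. 315 (1999),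
  §2 (2.3), §3 (3.1).
* [Humphreys1972] J. E. Humphreys, *Introduction to Lie Algebras and Representation Theory* (1972), §5.2, §7.
-/

open scoped TensorProduct

namespace Literature.AlgebraicGeometry.Motives

open Module
open Literature.Algebra.Lie

universe u

variable {V : Type u} [AddCommGroup V] [Module ℚ V] [Module.Finite ℚ V] [HodgeTensorFacts.{u, u}] {n : ℤ}

namespace HodgeStructure

/-! ## §1 The ideal `𝔰 = ⟨B₀, C₀, Θ⟩` -/

omit [Module.Finite ℚ V] [HodgeTensorFacts.{u, u}] in
/-- **Bracket relations of the plus pair**: `C₀ Q = 0`, `C₀ V ⊆ Q`, `[B₀, C₀] = μ₀ Θ`, `[Θ, B₀] = 2B₀`, `[Θ, C₀] = −2C₀`, and two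
operators agreeing on `P` and on `Q` are equal. [cite: Deligne1982HodgeCycles, I §3 Example 3.7] [cite: Humphreys1972, §7.1] -/
theorem PlusPairTwin.facts (H : HodgeStructure V n) (hn : n = 1) (heff : H.IsEffective)
    {Θ : Module.End ℂ (ℂ ⊗[ℚ] V)} (hΘ : ∀ p, ∀ x ∈ H.piece p (n - p), Θ x = ((2 * p - n : ℤ) : ℂ) • x)
    {B₀ C₀ : Module.End ℂ (ℂ ⊗[ℚ] V)} (hB₀P : ∀ p ∈ H.piece 1 0, B₀ p = 0) (hB₀im : ∀ v, B₀ v ∈ H.piece 1 0)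
    (hC₀ : ∀ v, C₀ v = conj (B₀ (conj v))) {μ₀ : ℂ}
    (hBC : ∀ p ∈ H.piece 1 0, B₀ (C₀ p) = μ₀ • p) (hCB : ∀ q ∈ H.piece 0 1, C₀ (B₀ q) = μ₀ • q) :
    (∀ q ∈ H.piece 0 1, C₀ q = 0) ∧ (∀ v, C₀ v ∈ H.piece 0 1) ∧ B₀ * C₀ - C₀ * B₀ = μ₀ • Θ ∧
      Θ * B₀ - B₀ * Θ = (2 : ℂ) • B₀ ∧ Θ * C₀ - C₀ * Θ = -((2 : ℂ) • C₀) ∧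
      (∀ Y Y' : Module.End ℂ (ℂ ⊗[ℚ] V), (∀ p ∈ H.piece 1 0, Y p = Y' p) → (∀ q ∈ H.piece 0 1, Y q = Y' q) → Y = Y') := by
  subst hn
  obtain ⟨hPmem, hQmem, hΘ10, hΘ01, -⟩ := UnitaryTheta.theta_facts H rfl heff hΘ
  have hC₀Q : ∀ q ∈ H.piece 0 1, C₀ q = 0 := fun q hq => by
    rw [hC₀, hB₀P _ (conj_mem_piece H hq), map_zero]
  have hC₀im : ∀ v, C₀ v ∈ H.piece 0 1 := fun v => by
    rw [hC₀]; exact conj_mem_piece H (hB₀im _)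
  have hPQv : ∀ v : ℂ ⊗[ℚ] V, (2 : ℂ)⁻¹ • (v + Θ v) + (2 : ℂ)⁻¹ • (v - Θ v) = v := fun v => by module
  have hext : ∀ Y Y' : Module.End ℂ (ℂ ⊗[ℚ] V), (∀ p ∈ H.piece 1 0, Y p = Y' p) →
      (∀ q ∈ H.piece 0 1, Y q = Y' q) → Y = Y' := fun Y Y' h1 h2 =>
    LinearMap.ext fun v => by rw [← hPQv v, map_add, map_add, h1 _ (hPmem v), h2 _ (hQmem v)]
  refine ⟨hC₀Q, hC₀im, ?_, ?_, ?_, hext⟩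
  · exact hext _ _ (fun p hp => by
        rw [LinearMap.sub_apply, Module.End.mul_apply, Module.End.mul_apply, hBC p hp, hB₀P p hp, map_zero, sub_zero,
          LinearMap.smul_apply, hΘ10 p hp])
      (fun q hq => by
        rw [LinearMap.sub_apply, Module.End.mul_apply, Module.End.mul_apply, hC₀Q q hq, map_zero, zero_sub, hCB q hq,
          LinearMap.smul_apply, hΘ01 q hq, smul_neg])
  · exact hext _ _ (fun p hp => by
        rw [LinearMap.sub_apply, Module.End.mul_apply, Module.End.mul_apply, hB₀P p hp, map_zero, hΘ10 p hp, hB₀P p hp,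
          sub_zero, LinearMap.smul_apply, hB₀P p hp, smul_zero])
      (fun q hq => by
        rw [LinearMap.sub_apply, Module.End.mul_apply, Module.End.mul_apply, hΘ10 _ (hB₀im q), hΘ01 q hq, map_neg,
          sub_neg_eq_add, LinearMap.smul_apply, two_smul])
  · exact hext _ _ (fun p hp => by
        rw [LinearMap.sub_apply, Module.End.mul_apply, Module.End.mul_apply, hΘ01 _ (hC₀im p), hΘ10 p hp,
          LinearMap.neg_apply, LinearMap.smul_apply, two_smul, neg_add, sub_eq_add_neg])
      (fun q hq => by
        rw [LinearMap.sub_apply, Module.End.mul_apply, Module.End.mul_apply, hC₀Q q hq, map_zero, hΘ01 q hq, map_neg,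
          hC₀Q q hq, neg_zero, sub_zero, LinearMap.neg_apply, LinearMap.smul_apply, hC₀Q q hq, smul_zero, neg_zero])

/-- **`𝔰 = ⟨B₀, C₀, Θ⟩_ℂ` is an ideal of `𝔥_ℂ`**: for `Y = Y₋ + Y₀ + Y₊ ∈ 𝔥_ℂ` (`ad Θ`-grading), `Y₊ ∈ ℂB₀`, `Y₋ ∈ ℂC₀`, and
`[Y₀, B₀]` is raising (so in `ℂB₀`), `[Y₀, C₀]` lowering, `[Y₀, Θ] = 0`. [cite: Deligne1982HodgeCycles, I §3 Example 3.7]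
[cite: MoonenZarhin1999LowDim, §2 (2.3)] -/
theorem PlusPairTwin.lie_mem_span (H : HodgeStructure V n) (hn : n = 1) (heff : H.IsEffective)
    {Θ : Module.End ℂ (ℂ ⊗[ℚ] V)} (hΘ : ∀ p, ∀ x ∈ H.piece p (n - p), Θ x = ((2 * p - n : ℤ) : ℂ) • x)
    {B₀ C₀ : Module.End ℂ (ℂ ⊗[ℚ] V)} (hB₀ : B₀ ∈ H.hodgeLieC) (hB₀P : ∀ p ∈ H.piece 1 0, B₀ p = 0)
    (hB₀im : ∀ v, B₀ v ∈ H.piece 1 0) (hC₀ : ∀ v, C₀ v = conj (B₀ (conj v))) {μ₀ : ℂ}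
    (hBC : ∀ p ∈ H.piece 1 0, B₀ (C₀ p) = μ₀ • p) (hCB : ∀ q ∈ H.piece 0 1, C₀ (B₀ q) = μ₀ • q)
    (hline : ∀ B ∈ H.hodgeLieC, (∀ p ∈ H.piece 1 0, B p = 0) → (∀ v, B v ∈ H.piece 1 0) → ∃ c : ℂ, B = c • B₀)
    (hline' : ∀ C ∈ H.hodgeLieC, (∀ q ∈ H.piece 0 1, C q = 0) → (∀ v, C v ∈ H.piece 0 1) → ∃ c : ℂ, C = c • C₀) :
    ∀ Y ∈ H.hodgeLieC, ∀ s ∈ Submodule.span ℂ (Set.range ![B₀, C₀, Θ]),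
      Y * s - s * Y ∈ Submodule.span ℂ (Set.range ![B₀, C₀, Θ]) := by
  obtain ⟨hC₀Q, hC₀im, hcomm, hΘB, hΘC, hext⟩ := PlusPairTwin.facts H hn heff hΘ hB₀P hB₀im hC₀ hBC hCB
  subst hn
  obtain ⟨hPmem, hQmem, hΘ10, hΘ01, hΘΘ⟩ := UnitaryTheta.theta_facts H rfl heff hΘ
  have hΘM : Θ ∈ H.hodgeLieC := H.mem_hodgeLieC_of_forall_piece hΘ
  have hbrM : ∀ Y ∈ H.hodgeLieC, ∀ Z ∈ H.hodgeLieC, Y * Z - Z * Y ∈ H.hodgeLieC := fun Y hY Z hZ =>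
    H.commutator_mem_hodgeLieC hY hZ
  set 𝔰 := Submodule.span ℂ (Set.range ![B₀, C₀, Θ]) with h𝔰
  have hB₀𝔰 : B₀ ∈ 𝔰 := Submodule.subset_span ⟨0, rfl⟩
  have hC₀𝔰 : C₀ ∈ 𝔰 := Submodule.subset_span ⟨1, rfl⟩
  have hΘ𝔰 : Θ ∈ 𝔰 := Submodule.subset_span ⟨2, rfl⟩
  intro Y hY s hs
  obtain ⟨Ym, hYm, Y0, hY0, Yp, hYp, hYdec, hYpP, hYpim, hYmQ, hYmim, -, -, hY0P, hY0Q⟩ :=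
    SymplecticTheta.exists_decomp H.hodgeLieC hbrM hΘM hΘΘ hΘ10 hΘ01 hPmem hQmem hY
  obtain ⟨a, hYpeq⟩ := hline Yp hYp hYpP hYpim
  obtain ⟨b, hYmeq⟩ := hline' Ym hYm hYmQ hYmim
  -- the three brackets with the generators
  have hsplit : ∀ Z : Module.End ℂ (ℂ ⊗[ℚ] V),
      Y * Z - Z * Y = (Ym * Z - Z * Ym) + (Y0 * Z - Z * Y0) + (Yp * Z - Z * Yp) := fun Z => by
    rw [hYdec]; noncomm_ring
  have hYB : Y * B₀ - B₀ * Y ∈ 𝔰 := by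
    obtain ⟨a', hR⟩ := hline (Y0 * B₀ - B₀ * Y0) (hbrM _ hY0 _ hB₀)
      (fun p hp => by
        rw [LinearMap.sub_apply, Module.End.mul_apply, Module.End.mul_apply, hB₀P p hp, map_zero, hB₀P _ (hY0P p hp),
          sub_zero])
      (fun v => by
        rw [LinearMap.sub_apply, Module.End.mul_apply, Module.End.mul_apply]
        exact sub_mem (hY0P _ (hB₀im v)) (hB₀im _))
    have hX : Y * B₀ - B₀ * Y = -(b • (B₀ * C₀ - C₀ * B₀)) + (Y0 * B₀ - B₀ * Y0) := by
      rw [hsplit, hYmeq, hYpeq]; simp only [smul_mul_assoc, mul_smul_comm, smul_sub]; abel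
    rw [hX, hcomm, hR]
    exact add_mem (neg_mem (Submodule.smul_mem _ _ (Submodule.smul_mem _ _ hΘ𝔰))) (Submodule.smul_mem _ _ hB₀𝔰)
  have hYC : Y * C₀ - C₀ * Y ∈ 𝔰 := by
    obtain ⟨b', hR⟩ := hline' (Y0 * C₀ - C₀ * Y0) (hbrM _ hY0 _ (conjOp_mem_spanC hB₀ hC₀))
      (fun q hq => by
        rw [LinearMap.sub_apply, Module.End.mul_apply, Module.End.mul_apply, hC₀Q q hq, map_zero, hC₀Q _ (hY0Q q hq),
          sub_zero])
      (fun v => by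
        rw [LinearMap.sub_apply, Module.End.mul_apply, Module.End.mul_apply]
        exact sub_mem (hY0Q _ (hC₀im v)) (hC₀im _))
    have hX : Y * C₀ - C₀ * Y = a • (B₀ * C₀ - C₀ * B₀) + (Y0 * C₀ - C₀ * Y0) := by
      rw [hsplit, hYmeq, hYpeq]; simp only [smul_mul_assoc, mul_smul_comm, smul_sub]; abel
    rw [hX, hcomm, hR]
    exact add_mem (Submodule.smul_mem _ _ (Submodule.smul_mem _ _ hΘ𝔰)) (Submodule.smul_mem _ _ hC₀𝔰)
  have hYΘ : Y * Θ - Θ * Y ∈ 𝔰 := by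
    have hR : Y0 * Θ - Θ * Y0 = 0 :=
      hext _ _ (fun p hp => by
          rw [LinearMap.sub_apply, Module.End.mul_apply, Module.End.mul_apply, hΘ10 p hp, hΘ10 _ (hY0P p hp), sub_self,
            LinearMap.zero_apply])
        (fun q hq => by
          rw [LinearMap.sub_apply, Module.End.mul_apply, Module.End.mul_apply, hΘ01 q hq, hΘ01 _ (hY0Q q hq), map_neg,
            sub_self, LinearMap.zero_apply])
    have hX : Y * Θ - Θ * Y = -(b • (Θ * C₀ - C₀ * Θ)) + (Y0 * Θ - Θ * Y0) + -(a • (Θ * B₀ - B₀ * Θ)) := by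
      rw [hsplit, hYmeq, hYpeq]; simp only [smul_mul_assoc, mul_smul_comm, smul_sub]; abel
    rw [hX, hΘC, hR, hΘB]
    exact add_mem (add_mem (neg_mem (Submodule.smul_mem _ _ (neg_mem (Submodule.smul_mem _ _ hC₀𝔰)))) (zero_mem _))
      (neg_mem (Submodule.smul_mem _ _ (Submodule.smul_mem _ _ hB₀𝔰)))
  -- linearity in `s`
  obtain ⟨c, rfl⟩ := (Submodule.mem_span_range_iff_exists_fun ℂ).1 hs
  have h3 : ∑ i, c i • (![B₀, C₀, Θ] i) = c 0 • B₀ + c 1 • C₀ + c 2 • Θ := by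
    rw [Fin.sum_univ_three]; rfl
  rw [h3]
  have h : Y * (c 0 • B₀ + c 1 • C₀ + c 2 • Θ) - (c 0 • B₀ + c 1 • C₀ + c 2 • Θ) * Y =
      c 0 • (Y * B₀ - B₀ * Y) + c 1 • (Y * C₀ - C₀ * Y) + c 2 • (Y * Θ - Θ * Y) := by
    rw [mul_add, mul_add, add_mul, add_mul, mul_smul_comm, mul_smul_comm, mul_smul_comm, smul_mul_assoc, smul_mul_assoc,
      smul_mul_assoc, smul_sub, smul_sub, smul_sub]
    abel
  rw [h]
  exact add_mem (add_mem (Submodule.smul_mem _ _ hYB) (Submodule.smul_mem _ _ hYC)) (Submodule.smul_mem _ _ hYΘ)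

/-- **Every non-zero `ad 𝔥_ℂ`-stable subspace of `𝔰 = ⟨B₀, C₀, Θ⟩` is `𝔰`** (so `𝔰 ≅ 𝔰𝔩₂` is a MINIMAL ideal of `𝔥_ℂ`):
from `x = aB₀ + bC₀ + cΘ ∈ J` the brackets with `Θ` put `aB₀`, `bC₀`, `cΘ` in `J`, and any one of `B₀`, `C₀`, `Θ` generates.
[cite: Humphreys1972, §7.1 (sl₂ is simple)] [cite: Deligne1982HodgeCycles, I §3 Example 3.7] -/
theorem PlusPairTwin.span_le_of_ideal (H : HodgeStructure V n) (hn : n = 1) (heff : H.IsEffective)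
    {Θ : Module.End ℂ (ℂ ⊗[ℚ] V)} (hΘ : ∀ p, ∀ x ∈ H.piece p (n - p), Θ x = ((2 * p - n : ℤ) : ℂ) • x)
    {B₀ C₀ : Module.End ℂ (ℂ ⊗[ℚ] V)} (hB₀ : B₀ ∈ H.hodgeLieC) (hB₀P : ∀ p ∈ H.piece 1 0, B₀ p = 0)
    (hB₀im : ∀ v, B₀ v ∈ H.piece 1 0) (hC₀ : ∀ v, C₀ v = conj (B₀ (conj v))) {μ₀ : ℂ} (hμ₀ : μ₀ ≠ 0)
    (hBC : ∀ p ∈ H.piece 1 0, B₀ (C₀ p) = μ₀ • p) (hCB : ∀ q ∈ H.piece 0 1, C₀ (B₀ q) = μ₀ • q)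
    (J : Submodule ℂ (Module.End ℂ (ℂ ⊗[ℚ] V))) (hJ : J ≤ Submodule.span ℂ (Set.range ![B₀, C₀, Θ]))
    (hJst : ∀ Y ∈ H.hodgeLieC, ∀ j ∈ J, Y * j - j * Y ∈ J) (hJ0 : J ≠ ⊥) :
    Submodule.span ℂ (Set.range ![B₀, C₀, Θ]) ≤ J := by
  obtain ⟨hC₀Q, hC₀im, hcomm, hΘB, hΘC, hext⟩ := PlusPairTwin.facts H hn heff hΘ hB₀P hB₀im hC₀ hBC hCB
  have hΘM : Θ ∈ H.hodgeLieC := H.mem_hodgeLieC_of_forall_piece hΘ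
  have hC₀M : C₀ ∈ H.hodgeLieC := conjOp_mem_spanC hB₀ hC₀
  -- any one generator generates
  have hofΘ : Θ ∈ J → Submodule.span ℂ (Set.range ![B₀, C₀, Θ]) ≤ J := fun hΘJ => by
    have hB : B₀ ∈ J := by
      have h := hJst Θ hΘM Θ hΘJ
      have h2 := hJst B₀ hB₀ Θ hΘJ
      rw [← neg_sub, hΘB] at h2
      have h3 : B₀ = (-(2 : ℂ)⁻¹) • (-((2 : ℂ) • B₀)) := by
        rw [smul_neg, neg_smul, neg_neg, smul_smul, inv_mul_cancel₀ (two_ne_zero' ℂ), one_smul]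
      rw [h3]; exact Submodule.smul_mem _ _ h2
    have hC : C₀ ∈ J := by
      have h2 := hJst C₀ hC₀M Θ hΘJ
      rw [← neg_sub, hΘC, neg_neg] at h2
      have h3 : C₀ = (2 : ℂ)⁻¹ • ((2 : ℂ) • C₀) := by rw [smul_smul, inv_mul_cancel₀ (two_ne_zero' ℂ), one_smul]
      rw [h3]; exact Submodule.smul_mem _ _ h2
    rw [Submodule.span_le]
    rintro _ ⟨i, rfl⟩
    fin_cases i
    · exact hB
    · exact hC
    · exact hΘJ
  have hofB : B₀ ∈ J → Θ ∈ J := fun hBJ => by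
    have h2 := hJst C₀ hC₀M B₀ hBJ
    rw [← neg_sub, hcomm] at h2
    have h3 : Θ = (-μ₀⁻¹) • (-(μ₀ • Θ)) := by
      rw [smul_neg, neg_smul, neg_neg, smul_smul, inv_mul_cancel₀ hμ₀, one_smul]
    rw [h3]; exact Submodule.smul_mem _ _ h2
  have hofC : C₀ ∈ J → Θ ∈ J := fun hCJ => by
    have h2 := hJst B₀ hB₀ C₀ hCJ
    rw [hcomm] at h2
    have h3 : Θ = μ₀⁻¹ • (μ₀ • Θ) := by rw [smul_smul, inv_mul_cancel₀ hμ₀, one_smul]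
    rw [h3]; exact Submodule.smul_mem _ _ h2
  -- a non-zero element and its components
  obtain ⟨x, hxJ, hx0⟩ := (Submodule.ne_bot_iff J).1 hJ0
  obtain ⟨c, hc⟩ := (Submodule.mem_span_range_iff_exists_fun ℂ).1 (hJ hxJ)
  have hx : x = c 0 • B₀ + c 1 • C₀ + c 2 • Θ := by rw [← hc, Fin.sum_univ_three]; rfl
  have ht1 : Θ * x - x * Θ = (2 * c 0) • B₀ - (2 * c 1) • C₀ := by
    have h : Θ * x - x * Θ = c 0 • (Θ * B₀ - B₀ * Θ) + c 1 • (Θ * C₀ - C₀ * Θ) + c 2 • (Θ * Θ - Θ * Θ) := by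
      rw [hx]; simp only [mul_add, add_mul, smul_mul_assoc, mul_smul_comm, smul_sub]; abel
    rw [h, hΘB, hΘC, sub_self, smul_zero, add_zero, smul_neg, smul_smul, smul_smul, mul_comm (c 0), mul_comm (c 1),
      sub_eq_add_neg]
  have ht1J : Θ * x - x * Θ ∈ J := hJst Θ hΘM x hxJ
  have ht2 : Θ * (Θ * x - x * Θ) - (Θ * x - x * Θ) * Θ = (4 * c 0) • B₀ + (4 * c 1) • C₀ := by
    have h : Θ * (Θ * x - x * Θ) - (Θ * x - x * Θ) * Θ =
        (2 * c 0) • (Θ * B₀ - B₀ * Θ) - (2 * c 1) • (Θ * C₀ - C₀ * Θ) := by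
      rw [ht1]; simp only [mul_sub, sub_mul, smul_mul_assoc, mul_smul_comm, smul_sub]; abel
    rw [h, hΘB, hΘC, smul_neg, sub_neg_eq_add, smul_smul, smul_smul]
    congr 1 <;> congr 1 <;> ring
  have ht2J : Θ * (Θ * x - x * Θ) - (Θ * x - x * Θ) * Θ ∈ J := hJst Θ hΘM _ ht1J
  have haB : c 0 • B₀ ∈ J := by
    have h : c 0 • B₀ = (8 : ℂ)⁻¹ • ((Θ * (Θ * x - x * Θ) - (Θ * x - x * Θ) * Θ) + (2 : ℂ) • (Θ * x - x * Θ)) := by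
      rw [ht2, ht1]; module
    rw [h]; exact Submodule.smul_mem _ _ (add_mem ht2J (Submodule.smul_mem _ _ ht1J))
  have hbC : c 1 • C₀ ∈ J := by
    have h : c 1 • C₀ = (8 : ℂ)⁻¹ • ((Θ * (Θ * x - x * Θ) - (Θ * x - x * Θ) * Θ) - (2 : ℂ) • (Θ * x - x * Θ)) := by
      rw [ht2, ht1]; module
    rw [h]; exact Submodule.smul_mem _ _ (sub_mem ht2J (Submodule.smul_mem _ _ ht1J))
  have hcΘ : c 2 • Θ ∈ J := by
    have h : c 2 • Θ = x - c 0 • B₀ - c 1 • C₀ := by rw [hx]; abel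
    rw [h]; exact sub_mem (sub_mem hxJ haB) hbC
  by_cases h2 : c 2 = 0
  · by_cases h0 : c 0 = 0
    · by_cases h1 : c 1 = 0
      · exfalso; apply hx0; rw [hx, h0, h1, h2, zero_smul, zero_smul, zero_smul, add_zero, add_zero]
      · have hC : C₀ ∈ J := by
          have h : C₀ = (c 1)⁻¹ • (c 1 • C₀) := by rw [smul_smul, inv_mul_cancel₀ h1, one_smul]
          rw [h]; exact Submodule.smul_mem _ _ hbC
        exact hofΘ (hofC hC)
    · have hB : B₀ ∈ J := by
        have h : B₀ = (c 0)⁻¹ • (c 0 • B₀) := by rw [smul_smul, inv_mul_cancel₀ h0, one_smul]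
        rw [h]; exact Submodule.smul_mem _ _ haB
      exact hofΘ (hofB hB)
  · have hΘJ : Θ ∈ J := by
      have h : Θ = (c 2)⁻¹ • (c 2 • Θ) := by rw [smul_smul, inv_mul_cancel₀ h2, one_smul]
      rw [h]; exact Submodule.smul_mem _ _ hcΘ
    exact hofΘ hΘJ

omit [Module.Finite ℚ V] [HodgeTensorFacts.{u, u}] in
/-- **`dim_ℂ ⟨B₀, C₀, Θ⟩ = 3`**: `B₀` (raising), `C₀` (lowering) and `Θ` (diagonal) are linearly independent.
[cite: Humphreys1972, §7.1] -/
theorem PlusPairTwin.finrank_span (H : HodgeStructure V n) (hn : n = 1) (heff : H.IsEffective)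
    {Θ : Module.End ℂ (ℂ ⊗[ℚ] V)} (hΘ : ∀ p, ∀ x ∈ H.piece p (n - p), Θ x = ((2 * p - n : ℤ) : ℂ) • x)
    {B₀ C₀ : Module.End ℂ (ℂ ⊗[ℚ] V)} (hB₀0 : B₀ ≠ 0) (hB₀P : ∀ p ∈ H.piece 1 0, B₀ p = 0)
    (hB₀im : ∀ v, B₀ v ∈ H.piece 1 0) (hC₀ : ∀ v, C₀ v = conj (B₀ (conj v))) {μ₀ : ℂ} (hμ₀ : μ₀ ≠ 0)
    (hBC : ∀ p ∈ H.piece 1 0, B₀ (C₀ p) = μ₀ • p) (hCB : ∀ q ∈ H.piece 0 1, C₀ (B₀ q) = μ₀ • q) :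
    Module.finrank ℂ (Submodule.span ℂ (Set.range ![B₀, C₀, Θ])) = 3 := by
  obtain ⟨hC₀Q, hC₀im, hcomm, hΘB, hΘC, hext⟩ := PlusPairTwin.facts H hn heff hΘ hB₀P hB₀im hC₀ hBC hCB
  subst hn
  obtain ⟨hPmem, hQmem, hΘ10, hΘ01, -⟩ := UnitaryTheta.theta_facts H rfl heff hΘ
  -- a `q ∈ Q` with `B₀ q ≠ 0`
  obtain ⟨q, hq, hBq⟩ : ∃ q ∈ H.piece 0 1, B₀ q ≠ 0 := by
    by_contra hno
    push Not at hno
    apply hB₀0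
    refine hext _ _ (fun p hp => by rw [hB₀P p hp, LinearMap.zero_apply]) (fun q hq => by
      rw [hno q hq, LinearMap.zero_apply])
  have hq0 : q ≠ 0 := fun h => hBq (by rw [h, map_zero])
  -- `P ∩ Q = 0`
  have hPQ : ∀ x, x ∈ H.piece 1 0 → x ∈ H.piece 0 1 → x = 0 := fun x hP hQ => by
    have h1 := hΘ10 x hP
    rw [hΘ01 x hQ] at h1
    have h2 : (2 : ℂ) • x = 0 := by rw [two_smul]; nth_rewrite 1 [← h1]; rw [neg_add_cancel]
    exact (smul_eq_zero.1 h2).resolve_left (two_ne_zero' ℂ)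
  have hli : LinearIndependent ℂ ![B₀, C₀, Θ] := by
    rw [Fintype.linearIndependent_iff]
    intro g hg
    rw [Fin.sum_univ_three] at hg
    change g 0 • B₀ + g 1 • C₀ + g 2 • Θ = 0 at hg
    -- apply to `q`: `g 0 • B₀ q - g 2 • q = 0`
    have h1 : g 0 • B₀ q + -(g 2 • q) = 0 := by
      have h := LinearMap.congr_fun hg q
      rw [LinearMap.add_apply, LinearMap.add_apply, LinearMap.smul_apply, LinearMap.smul_apply, LinearMap.smul_apply,
        hC₀Q q hq, smul_zero, add_zero, hΘ01 q hq, smul_neg, LinearMap.zero_apply] at h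
      exact h
    have h1' : g 0 • B₀ q = g 2 • q := by rw [← sub_eq_zero, sub_eq_add_neg]; exact h1
    have hg0 : g 0 = 0 := by
      have hmem : g 0 • B₀ q ∈ H.piece 0 1 := by rw [h1']; exact Submodule.smul_mem _ _ hq
      have h0 := hPQ _ (Submodule.smul_mem _ _ (hB₀im q)) hmem
      exact (smul_eq_zero.1 h0).resolve_right hBq
    have hg2 : g 2 = 0 := by
      rw [hg0, zero_smul] at h1'
      exact (smul_eq_zero.1 h1'.symm).resolve_right hq0
    have hg1 : g 1 = 0 := by
      rw [hg0, hg2, zero_smul, zero_smul, zero_add, add_zero] at hg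
      have h := LinearMap.congr_fun hg (B₀ q)
      rw [LinearMap.smul_apply, hCB q hq, LinearMap.zero_apply, smul_smul] at h
      exact (mul_eq_zero.1 ((smul_eq_zero.1 h).resolve_right hq0)).resolve_right hμ₀
    intro i
    fin_cases i
    · exact hg0
    · exact hg1
    · exact hg2
  rw [finrank_span_eq_card hli, Fintype.card_fin]

/-! ## §2 `𝔥_ℂ = 𝔰` or a three-dimensional twin ideal -/

set_option maxHeartbeats 800000 in
/-- **Plus pair in weight one: `𝔥_ℂ = ⟨B₀, C₀, Θ⟩` or `𝔥_ℂ` has a three-dimensional ideal commuting with `⟨B₀, C₀, Θ⟩`.**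
With `𝔰 := ⟨B₀, C₀, Θ⟩_ℂ` (an ideal `≅ 𝔰𝔩₂` of `𝔥_ℂ = Lie Hg(H) ⊗ ℂ`): EITHER `𝔥_ℂ ≤ 𝔰`, OR `𝔥_ℂ = W ⊕ C` for `ad 𝔥_ℂ`-stable
subspaces `W`, `C` with `[W, C] = 0`, `dim_ℂ W = 3` and `[W, 𝔰] = 0`.  This is Jacobson's theorem that the complexification of the
`ℚ`-SIMPLE algebra `Lie Hg` (`isSimple_hodgeLie_of_plusLine`) is a sum of simple ideals of one and the same dimension, applied to
the simple ideal `𝔰`: transport along `ℂ ⊗_ℚ 𝔥 ≃ 𝔥_ℂ` (`exists_lieEquiv_baseChange_spanC`), semisimplicity of the base change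
(`KillingBaseChange.isSemisimple_baseChange`), minimality of `𝔰` (`PlusPairTwin.span_le_of_ideal`, hence simplicity by
`LieAlgebra.IsSemisimple.isSimple_of_isAtom`) and `exists_ideal_finrank_eq_of_isSimple_ideal`.
[cite: Jacobson1962LieAlgebras, Ch. X §1 Theorems 1–3 (pp. 290–293)] [cite: Deligne1982HodgeCycles, I §3 Prop. 3.6, Example 3.7]
[cite: MoonenZarhin1999LowDim, §2 (2.3), §3 (3.1)] -/
theorem exists_twin_ideal_of_plusPair (H : HodgeStructure V n) (ψ : H.Polarization) (hn : n = 1)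
    (heff : H.IsEffective) {Θ : Module.End ℂ (ℂ ⊗[ℚ] V)}
    (hΘ : ∀ p, ∀ x ∈ H.piece p (n - p), Θ x = ((2 * p - n : ℤ) : ℂ) • x)
    {B₀ C₀ : Module.End ℂ (ℂ ⊗[ℚ] V)} (hB₀ : B₀ ∈ H.hodgeLieC) (hB₀0 : B₀ ≠ 0)
    (hB₀P : ∀ p ∈ H.piece 1 0, B₀ p = 0) (hB₀im : ∀ v, B₀ v ∈ H.piece 1 0)
    (hC₀ : ∀ v, C₀ v = conj (B₀ (conj v))) {μ₀ : ℂ} (hμ₀ : μ₀ ≠ 0)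
    (hBC : ∀ p ∈ H.piece 1 0, B₀ (C₀ p) = μ₀ • p) (hCB : ∀ q ∈ H.piece 0 1, C₀ (B₀ q) = μ₀ • q)
    (hline : ∀ B ∈ H.hodgeLieC, (∀ p ∈ H.piece 1 0, B p = 0) → (∀ v, B v ∈ H.piece 1 0) → ∃ c : ℂ, B = c • B₀)
    (hline' : ∀ C ∈ H.hodgeLieC, (∀ q ∈ H.piece 0 1, C q = 0) → (∀ v, C v ∈ H.piece 0 1) → ∃ c : ℂ, C = c • C₀)
    (hz : H.hodgeLie ⊓ Subalgebra.toSubmodule H.endAlg = ⊥) :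
    H.hodgeLieC ≤ Submodule.span ℂ (Set.range ![B₀, C₀, Θ]) ∨
    ∃ W C : Submodule ℂ (Module.End ℂ (ℂ ⊗[ℚ] V)), W ≤ H.hodgeLieC ∧ C ≤ H.hodgeLieC ∧ W ⊓ C = ⊥ ∧
      W ⊔ C = H.hodgeLieC ∧ Module.finrank ℂ W = 3 ∧
      (∀ Y ∈ H.hodgeLieC, ∀ w ∈ W, Y * w - w * Y ∈ W) ∧ (∀ Y ∈ H.hodgeLieC, ∀ c ∈ C, Y * c - c * Y ∈ C) ∧
      (∀ w ∈ W, ∀ c ∈ C, w * c = c * w) ∧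
      (∀ w ∈ W, ∀ s ∈ Submodule.span ℂ (Set.range ![B₀, C₀, Θ]), w * s = s * w) := by
  classical
  letI iQ : LieRing (Module.End ℚ V) := LieRing.ofAssociativeRing
  letI iC : LieRing (Module.End ℂ (ℂ ⊗[ℚ] V)) := LieRing.ofAssociativeRing
  set 𝔰 := Submodule.span ℂ (Set.range ![B₀, C₀, Θ]) with h𝔰def
  have hideal := PlusPairTwin.lie_mem_span H hn heff hΘ hB₀ hB₀P hB₀im hC₀ hBC hCB hline hline'
  have hatom := PlusPairTwin.span_le_of_ideal H hn heff hΘ hB₀ hB₀P hB₀im hC₀ hμ₀ hBC hCB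
  have hdim := PlusPairTwin.finrank_span H hn heff hΘ hB₀0 hB₀P hB₀im hC₀ hμ₀ hBC hCB
  have hΘM : Θ ∈ H.hodgeLieC := H.mem_hodgeLieC_of_forall_piece hΘ
  have hC₀M : C₀ ∈ H.hodgeLieC := conjOp_mem_spanC hB₀ hC₀
  have hB₀𝔰 : B₀ ∈ 𝔰 := Submodule.subset_span ⟨0, rfl⟩
  have h𝔰le : 𝔰 ≤ H.hodgeLieC := by
    rw [h𝔰def, Submodule.span_le]
    rintro _ ⟨i, rfl⟩
    fin_cases i
    · exact hB₀
    · exact hC₀M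
    · exact hΘM
  -- the rational Lie algebra `𝔏 = Lie Hg` (simple) and the complex one `𝔏'` with carrier `𝔥_ℂ`
  obtain ⟨𝔏, h𝔏⟩ := exists_lieSubalgebra_eq_hodgeLie H
  obtain ⟨𝔏', h𝔏'⟩ := exists_lieSubalgebra_eq_hodgeLieC H
  have hmem𝔏' : ∀ {x}, x ∈ 𝔏' ↔ x ∈ H.hodgeLieC := fun {x} => by rw [← LieSubalgebra.mem_toSubmodule, h𝔏']
  haveI hsimple : LieAlgebra.IsSimple ℚ 𝔏 :=
    isSimple_hodgeLie_of_plusLine H ψ hn heff hΘ hB₀ hB₀0 hB₀P hB₀im hC₀ hμ₀ hBC hCB hline hz 𝔏 h𝔏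
  haveI : Module.Finite ℚ 𝔏 := Module.Finite.of_injective 𝔏.toSubmodule.subtype Subtype.val_injective
  have hspan : 𝔏'.toSubmodule = spanC 𝔏.toSubmodule := by rw [h𝔏', h𝔏, hodgeLieC_eq_spanC]
  obtain ⟨e, -⟩ := exists_lieEquiv_baseChange_spanC 𝔏 𝔏' hspan
  haveI hss : LieAlgebra.IsSemisimple ℂ (ℂ ⊗[ℚ] 𝔏) :=
    KillingBaseChange.isSemisimple_baseChange (k := ℚ) (K := ℂ) (L := 𝔏)
  -- `Φ = val ∘ e : ℂ ⊗ 𝔏 → End(V_ℂ)`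
  let Φ : ℂ ⊗[ℚ] 𝔏 →ₗ[ℂ] Module.End ℂ (ℂ ⊗[ℚ] V) :=
    𝔏'.toSubmodule.subtype ∘ₗ ((e : ℂ ⊗[ℚ] 𝔏 →ₗ⁅ℂ⁆ 𝔏') : ℂ ⊗[ℚ] 𝔏 →ₗ[ℂ] 𝔏')
  have hΦ : ∀ y, Φ y = ((e y : 𝔏') : Module.End ℂ (ℂ ⊗[ℚ] V)) := fun y => rfl
  have hΦinj : Function.Injective Φ := fun y z h => e.injective (Subtype.ext (by exact h))
  have hΦmem : ∀ y, Φ y ∈ H.hodgeLieC := fun y => hmem𝔏'.1 (e y).2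
  have hΦsurj : ∀ Y ∈ H.hodgeLieC, ∃ y, Φ y = Y := fun Y hY =>
    ⟨e.symm ⟨Y, hmem𝔏'.2 hY⟩, by rw [hΦ, LieEquiv.apply_symm_apply]⟩
  have hΦlie : ∀ y z : ℂ ⊗[ℚ] 𝔏, Φ ⁅y, z⁆ = Φ y * Φ z - Φ z * Φ y := fun y z => by
    rw [hΦ, hΦ, hΦ, e.map_lie, LieSubalgebra.coe_bracket, LieRing.of_associative_ring_bracket]
  -- images of ideals are `ad 𝔥_ℂ`-stable; disjoint ideals give commuting images
  have hst : ∀ I : LieIdeal ℂ (ℂ ⊗[ℚ] 𝔏), ∀ Y ∈ H.hodgeLieC, ∀ j ∈ I.toSubmodule.map Φ,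
      Y * j - j * Y ∈ I.toSubmodule.map Φ := by
    rintro I Y hY _ ⟨i, hi, rfl⟩
    obtain ⟨y, rfl⟩ := hΦsurj Y hY
    exact ⟨⁅y, i⁆, I.lie_mem hi, hΦlie y i⟩
  have hcomm0 : ∀ I I' : LieIdeal ℂ (ℂ ⊗[ℚ] 𝔏), I ⊓ I' = ⊥ → ∀ i ∈ I, ∀ j ∈ I', Φ i * Φ j = Φ j * Φ i := by
    intro I I' hII' i hi j hj
    have h1 : ⁅i, j⁆ ∈ I' := I'.lie_mem hj
    have h2 : ⁅i, j⁆ ∈ I := by rw [← lie_skew]; exact neg_mem (I.lie_mem hi)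
    have h0 : ⁅i, j⁆ = 0 := by
      have h : ⁅i, j⁆ ∈ I ⊓ I' := (LieSubmodule.mem_inf _ _ _).2 ⟨h2, h1⟩
      rwa [hII', LieSubmodule.mem_bot] at h
    rw [← sub_eq_zero, ← hΦlie, h0, map_zero]
  have hfin : ∀ I : LieIdeal ℂ (ℂ ⊗[ℚ] 𝔏),
      Module.finrank ℂ (I.toSubmodule.map Φ) = Module.finrank ℂ I.toSubmodule := fun I =>
    (Submodule.equivMapOfInjective Φ hΦinj I.toSubmodule).finrank_eq.symm
  -- the ideal `𝔰'` of `𝔏'` over `𝔰` and its pull-back `S`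
  let 𝔰' : LieIdeal ℂ 𝔏' :=
    { (𝔰.comap 𝔏'.toSubmodule.subtype) with
      lie_mem := fun {x m} hm => by
        change ((⁅x, m⁆ : 𝔏') : Module.End ℂ (ℂ ⊗[ℚ] V)) ∈ 𝔰
        rw [LieSubalgebra.coe_bracket, LieRing.of_associative_ring_bracket]
        exact hideal _ (hmem𝔏'.1 x.2) _ hm }
  have hmem𝔰' : ∀ x : 𝔏', x ∈ 𝔰' ↔ (x : Module.End ℂ (ℂ ⊗[ℚ] V)) ∈ 𝔰 := fun x => Iff.rfl
  set S : LieIdeal ℂ (ℂ ⊗[ℚ] 𝔏) := 𝔰'.comap (e : ℂ ⊗[ℚ] 𝔏 →ₗ⁅ℂ⁆ 𝔏') with hSdef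
  have hmemS : ∀ y, y ∈ S ↔ Φ y ∈ 𝔰 := fun y => by
    rw [hSdef, LieIdeal.mem_comap]
    exact hmem𝔰' _
  have hSmap : S.toSubmodule.map Φ = 𝔰 := by
    refine le_antisymm ?_ fun x hx => ?_
    · rintro _ ⟨y, hy, rfl⟩; exact (hmemS y).1 hy
    · obtain ⟨y, rfl⟩ := hΦsurj x (h𝔰le hx)
      exact ⟨y, (hmemS y).2 hx, rfl⟩
  have hSfin : Module.finrank ℂ S.toSubmodule = 3 := by rw [← hfin S, hSmap, hdim]
  -- `S` is a minimal ideal, hence simple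
  have hS0 : S ≠ ⊥ := by
    obtain ⟨y₀, hy₀⟩ := hΦsurj B₀ hB₀
    intro hS
    have hyS : y₀ ∈ S := (hmemS y₀).2 (hy₀ ▸ hB₀𝔰)
    rw [hS, LieSubmodule.mem_bot] at hyS
    apply hB₀0
    rw [← hy₀, hyS, map_zero]
  have hSmin : ∀ I : LieIdeal ℂ (ℂ ⊗[ℚ] 𝔏), I ≤ S → I ≠ ⊥ → S ≤ I := by
    intro I hIS hI0
    have hJle : I.toSubmodule.map Φ ≤ 𝔰 := by
      rintro _ ⟨i, hi, rfl⟩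
      exact (hmemS i).1 (hIS hi)
    have hJ0 : I.toSubmodule.map Φ ≠ ⊥ := by
      intro hJ0
      apply hI0
      rw [eq_bot_iff]
      intro i hi
      rw [LieSubmodule.mem_bot]
      apply hΦinj
      rw [map_zero]
      have h : Φ i ∈ I.toSubmodule.map Φ := ⟨i, hi, rfl⟩
      rwa [hJ0, Submodule.mem_bot] at h
    have h𝔰J := hatom _ hJle (hst I) hJ0
    intro y hy
    obtain ⟨i, hi, hiy⟩ := h𝔰J ((hmemS y).1 hy)
    rw [← hΦinj hiy]
    exact hi
  have hSatom : IsAtom S :=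
    ⟨hS0, fun I hlt => by
      by_contra hI0
      exact lt_irrefl S (lt_of_le_of_lt (hSmin I hlt.le hI0) hlt)⟩
  haveI hSsimple : LieAlgebra.IsSimple ℂ S := LieAlgebra.IsSemisimple.isSimple_of_isAtom S hSatom
  -- Jacobson: `Sᶜ = 0` or `Sᶜ` contains an ideal of dimension `dim S = 3`
  rcases exists_ideal_finrank_eq_of_isSimple_ideal S Sᶜ inf_compl_eq_bot sup_compl_eq_top with hK | ⟨W, hWK, hWdim⟩
  · left
    have hS : S = ⊤ := by rw [← sup_bot_eq S, ← hK]; exact sup_compl_eq_top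
    intro Y hY
    obtain ⟨y, rfl⟩ := hΦsurj Y hY
    exact (hmemS y).1 (by rw [hS]; exact LieSubmodule.mem_top y)
  · right
    have hWS : W ⊓ S = ⊥ := by
      rw [eq_bot_iff]
      calc W ⊓ S ≤ Sᶜ ⊓ S := inf_le_inf_right S hWK
        _ = ⊥ := compl_inf_eq_bot
    refine ⟨W.toSubmodule.map Φ, (Wᶜ).toSubmodule.map Φ, ?_, ?_, ?_, ?_, ?_, hst W, hst Wᶜ,
      fun w hw c hc => ?_, fun w hw s hs => ?_⟩
    · rintro _ ⟨i, -, rfl⟩; exact hΦmem i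
    · rintro _ ⟨i, -, rfl⟩; exact hΦmem i
    · rw [eq_bot_iff]
      intro x hx
      obtain ⟨⟨i, hi, rfl⟩, ⟨j, hj, hji⟩⟩ := Submodule.mem_inf.1 hx
      rw [Submodule.mem_bot]
      have hij : j = i := hΦinj hji
      subst hij
      have h : j ∈ W ⊓ Wᶜ := (LieSubmodule.mem_inf _ _ _).2 ⟨hi, hj⟩
      rw [inf_compl_eq_bot, LieSubmodule.mem_bot] at h
      rw [h, map_zero]
    · refine le_antisymm (sup_le ?_ ?_) fun Y hY => ?_
      · rintro _ ⟨i, -, rfl⟩; exact hΦmem i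
      · rintro _ ⟨i, -, rfl⟩; exact hΦmem i
      · obtain ⟨y, rfl⟩ := hΦsurj Y hY
        have hy : y ∈ W ⊔ Wᶜ := by rw [sup_compl_eq_top]; exact LieSubmodule.mem_top y
        obtain ⟨w, hw, c, hc, rfl⟩ := (LieSubmodule.mem_sup _ _ _).1 hy
        rw [map_add]
        exact Submodule.add_mem_sup ⟨w, hw, rfl⟩ ⟨c, hc, rfl⟩
    · rw [hfin W, hWdim, hSfin]
    · obtain ⟨i, hi, rfl⟩ := hw
      obtain ⟨j, hj, rfl⟩ := hc
      exact hcomm0 W Wᶜ inf_compl_eq_bot i hi j hj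
    · obtain ⟨i, hi, rfl⟩ := hw
      obtain ⟨y, rfl⟩ := hΦsurj s (h𝔰le hs)
      exact hcomm0 W S hWS i hi y ((hmemS y).2 hs)

end HodgeStructure

end Literature.AlgebraicGeometry.Motives
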